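import Literature.AlgebraicGeometry.HodgeTheory.AlgebraicMonodromyMumfordTate
import HarnessLib

/-!
# Density of unitary reflection groups: a subgroup of `U(p,q)` generated by complex reflections of
# finite order along one orbit of unit vectors spanning `ℂ(p,q)` is finite or Zariski dense in `PU(p,q)`
# (Carlson–Toledo 1999, §7, Theorem `udensitytheo`; named fact, with the complex-reflection calculus proved)

Family `hodge`, layer `Literature/AlgebraicGeometry/HodgeTheory`. Companion of
`CyclicCoverReflectionMonodromy` (Carlson–Toledo §§2, 3, 6, 7: the monodromy group of the universal
family of `p`-cyclic covers of `ℙ²` is generated by reflections of order `p` along one orbit of vanishing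
lines — the `ℚ`-form `IsCyclicReflection B τ δ r`) and of `TransvectionMonodromyZariskiDense` (Deligne's
"Lemma T": transvections along a spanning connected set have Zariski closure `⊇ Sp`). This file vendors
the UNITARY analogue of Lemma T that Carlson–Toledo prove in §7 by adapting Deligne, Weil II §4.4: the
density theorem for groups generated by complex `λ`-reflections in a hermitian space. Written by the
literature-typing seat `littype-FH1-2` (cell `hodge-nonav`) at the request of the planner memo
`STUB-PLAN-B2-g19` §2 R3 / §5 (2a) for the crux K1-A `stub_unitaryReflectionDensity`
(`stmt-HodgeConjecture-19544`, line `unitary-reflection-zariski` v6) of the route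
`Summits/HodgeConjecture/HodgeConjecture/Theses/CyclicUnitaryPowers.lean`: on each eigenspace
`E_j = ker(τ − ζ^j) ⊂ V₀ ⊗ ℂ` of the covering transformation the monodromy group acts through
`h_j`-unitary complex reflections with eigenvalue `ζ^j` (Carlson–Toledo §6, Proposition), and this theorem
is the per-eigenspace ("per place") density input of that stub's Line R.

## Source, verbatim (J. A. Carlson, D. Toledo, *Discriminant complements and kernels of monodromy
## representations*, Duke Math. J. 97 (1999) 621–648 [CarlsonToledo1999]; read in the arXiv text
## `paper:arxiv-alg-geom_9708002`, page file p0015 (§7 "Density of unitary monodromy groups"); the arXiv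
## text carries TeX labels instead of theorem numbers, quoted as printed)

* p0015 L5–10: "We now show how the argument Deligne used in [DeWeTwo], section 4.4, to prove Theorem
  delignedensity can be adapted to establish a density theorem for groups generated by complex
  reflections on a space `ℂ(p,q)` endowed with a hermitian form `h` of signature `(p,q)`. If `A` is a
  subset of `ℂ(p,q)` or of `U(p,q)`, we use `PA` to denote its projection in `ℙ(ℂ(p,q))` or `PU(p,q)`."
* p0015 L12–21, **Theorem** (label `udensitytheo`): "Let `ε = ±1` be fixed, and let `Δ` be a set of
  vectors in a hermitian space `ℂ(p,q)` which lie in the unit quadric `h(δ,δ) = ε`. Fix a root of unity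
  `λ ≠ ±1` and let `Γ` be the subgroup of `U(p,q)` generated by the complex reflections
  `s_δ(x) = x + ε(λ − 1)h(x,δ)δ` for all `δ` in `Δ`. Suppose that `p + q > 1`, that `Δ` consists of a
  single `Γ`-orbit, and that `Δ` spans `ℂ(p,q)`. Then either `Γ` is finite or `PΓ` Zariski-dense in
  `PU(p,q)`."
* p0015 L23–33: "Let `Γ̄` be the Zariski closure of a subgroup `Γ` of `U(p,q)` which contains the
  `λ`-reflections for all vectors `δ` in a set `Δ`. Then `Γ̄` also contains the `λ`-reflections for the
  set `R = Γ̄Δ`. Indeed, if `g` is an element of `Γ̄`, then `g⁻¹ s_δ g = s_{g⁻¹(δ)}`.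
  (reflectionconjugacy)" — followed by the stronger Theorem `udensityprop` (the smallest algebraic
  subgroup `M ⊇ {s_δ}` with `R` a single `M`-orbit is finite or has `PM = PU(p,q)`), Lemma `Ulemma`
  (pairs of reflections in `U(2)` / `U(1,1)`) and the proof, pp. 15–16.

## Rendering (Mathlib carriers; what is a definition, what is proved, what is the fact)

* The hermitian space `ℂ(p,q)`: a finite-dimensional complex vector space `W` with a sesquilinear form
  `B : W →ₗ⋆[ℂ] W →ₗ[ℂ] ℂ` (Mathlib's convention: conjugate-linear in the FIRST variable) which is
  hermitian (`B.IsSymm`: `conj (B x y) = B y x`) and non-degenerate (`B.Nondegenerate`); `(p,q)` is its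
  signature, `p + q = dim W`, so "`p + q > 1`" reads `2 ≤ finrank ℂ W`. The source's `h(x,δ)` (linear in
  `x`) is `B δ x`.
* `complexReflection B ε l δ : W →ₗ[ℂ] W` — the source's `s_δ(x) = x + ε(λ − 1)h(x,δ)δ` (DEFINITION, with
  the calculus PROVED: `s_δ δ = λδ` and `s_δ = id` on `δ^⊥` when `h(δ,δ) = ε = ±1`; `s^λ_δ ∘ s^μ_δ = s^{λμ}_δ`,
  so `s_δ` has the order of `λ` (`complexReflection_pow_eq_one`) and is invertible
  (`complexReflectionEquiv`, inverse `s^{λ⁻¹}_δ`); `s_δ` is `h`-unitary when `|λ| = 1`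
  (`complexReflection_isometry`); the conjugation formula (reflectionconjugacy)
  `u⁻¹ s_δ u = s_{u⁻¹δ}` for unitary `u` (`complexReflection_conj`); every element of the group generated
  by such reflections is `h`-unitary (`isometry_of_mem_closure_setOf_coe_eq_complexReflection`)).
* `Γ`: the subgroup of `GL(W) = W ≃ₗ[ℂ] W` generated by the automorphisms whose underlying linear map is
  some `s_δ`, `δ ∈ Δ` (each `s_δ` is one). "`Δ` consists of a single `Γ`-orbit": `Δ` is `Γ`-stable and
  `Γ` is transitive on `Δ` (`Δ ≠ ∅` is forced by "`Δ` spans" and `dim W ≥ 2`).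
* "`PΓ` is Zariski-dense in `PU(p,q)`", on real points and in the tree's vocabulary
  (`AlgebraicMonodromyMumfordTate.glZariskiClosure` over `K = ℝ`, on the real vector space underlying
  `W`, `Module.complexToReal`): `restrictScalarsRealHom W : GL_ℂ(W) →* GL_ℝ(W)`, `unitScalarSubgroup W`
  = the unit scalars `z·1`, `|z| = 1` — the centre `U(1)` of `U(p,q)`, the kernel of `U(p,q) → PU(p,q)` —
  and `realPointsWithUnitScalars W Γ = Γ·U(1) ≤ GL_ℝ(W)`; the conclusion is that THE UNITARY GROUP
  `U(W,h)` LIES IN THE REAL ZARISKI CLOSURE OF `Γ·U(1)`: every real polynomial in the real matrix entries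
  vanishing on `Γ·U(1)` vanishes at every `h`-unitary `u`. (Equivalence with the printed clause: `S¹ =
  U(1)(ℝ)` and `U(W,h) = U(p,q)(ℝ)` are Zariski dense in the connected real algebraic groups `U(1)`,
  `U(p,q)`; the Zariski closure `G` of `Γ·S¹` is an algebraic subgroup of `U(p,q)` containing the central
  `U(1)`, and `G = U(p,q)` iff `G/U(1)` — the Zariski closure of `PΓ` in `PU(p,q) = U(p,q)/U(1)` — is all
  of `PU(p,q)`.)
* `carlsonToledo1999_unitaryReflection_zariskiDense` — the NAMED FACT (Theorem `udensitytheo` as printed,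
  all signatures at once). `-- TODO(general form): Theorem udensityprop (smallest algebraic subgroup M,
  R one M-orbit) and Lemma Ulemma (two reflections; "in the indefinite case Γ is never finite") are not
  vendored; nor is the consequence SU(W,h) ⊆ (Zariski closure of Γ)(ℝ), which needs [U,U] = SU at the
  level of algebraic groups.`

## References
* [CarlsonToledo1999] J. A. Carlson, D. Toledo, *Discriminant complements and kernels of monodromy
  representations*, Duke Math. J. 97 (1999), no. 3, 621–648, §7 (arXiv alg-geom/9708002, p. 15, Theorem
  `udensitytheo`, formula (reflectionconjugacy); proof pp. 15–16). [cite: CarlsonToledo1999, §7 Theorem udensitytheo]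
* [Deligne1980] P. Deligne, *La conjecture de Weil. II*, Publ. Math. IHÉS 52 (1980), §4.4 (the model of
  the proof). [cite: Deligne1980, §4.4]
* [CarlsonMullerStachPeters2017] J. Carlson, S. Müller-Stach, C. Peters, *Period mappings and period
  domains*, 2nd ed. (2017), Lemma–Definition 15.3.7 (Zariski closure of a monodromy group — the tree's
  `glZariskiClosure`). [cite: CarlsonMullerStachPeters2017, Lemma–Definition 15.3.7]
-/

noncomputable section

open Module

namespace Literature.AlgebraicGeometry.HodgeTheory

/-! ### §1 Complex `λ`-reflections in a hermitian space (definitions; calculus proved) -/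

section Reflection

variable {W : Type*} [AddCommGroup W] [Module ℂ W]

/-- The **complex `λ`-reflection** along `δ` with sign `ε`: Carlson–Toledo's
`s_δ(x) = x + ε(λ − 1) h(x,δ) δ`, for a sesquilinear form `B : W →ₗ⋆[ℂ] W →ₗ[ℂ] ℂ` in Mathlib's convention
(conjugate-linear in the first variable), so that the source's `h(x,δ)`, linear in `x`, is `B δ x`. When
`h(δ,δ) = ε = ±1` it fixes `δ^⊥` pointwise and multiplies `δ` by `λ`.
[cite: CarlsonToledo1999, §7 Theorem udensitytheo] -/
def complexReflection (B : W →ₗ⋆[ℂ] W →ₗ[ℂ] ℂ) (ε l : ℂ) (δ : W) : W →ₗ[ℂ] W :=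
  LinearMap.id + (ε * (l - 1)) • (B δ).smulRight δ

/-- `s_δ(x) = x + ε(λ − 1)h(x,δ)δ`. [cite: CarlsonToledo1999, §7 Theorem udensitytheo] -/
@[simp] theorem complexReflection_apply (B : W →ₗ⋆[ℂ] W →ₗ[ℂ] ℂ) (ε l : ℂ) (δ x : W) :
    complexReflection B ε l δ x = x + (ε * (l - 1) * B δ x) • δ := by
  simp [complexReflection, smul_smul]

/-- `s^1_δ = id`. [cite: CarlsonToledo1999, §7 Theorem udensitytheo] -/
theorem complexReflection_one (B : W →ₗ⋆[ℂ] W →ₗ[ℂ] ℂ) (ε : ℂ) (δ : W) :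
    complexReflection B ε 1 δ = LinearMap.id := by
  ext x; simp

/-- On the root itself: `s_δ(δ) = λδ` when `h(δ,δ) = ε`, `ε² = 1` ("complex reflection with eigenvalue
`λ`"). [cite: CarlsonToledo1999, §6 Proposition and §7 Theorem udensitytheo] -/
theorem complexReflection_apply_self (B : W →ₗ⋆[ℂ] W →ₗ[ℂ] ℂ) {ε : ℂ} (hε : ε * ε = 1) (l : ℂ) {δ : W}
    (hδ : B δ δ = ε) : complexReflection B ε l δ δ = l • δ := by
  rw [complexReflection_apply, hδ]
  have : ε * (l - 1) * ε = l - 1 := by linear_combination (l - 1) * hε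
  rw [this, sub_smul, one_smul, add_sub_cancel]

/-- `s_δ` is the identity on `δ^⊥ = {x | h(x,δ) = 0}`. [cite: CarlsonToledo1999, §6 "by the identity on V^⊥"] -/
theorem complexReflection_apply_of_orthogonal (B : W →ₗ⋆[ℂ] W →ₗ[ℂ] ℂ) (ε l : ℂ) {δ x : W}
    (hx : B δ x = 0) : complexReflection B ε l δ x = x := by
  simp [hx]

/-- Composition of reflections along the same unit root multiplies the eigenvalues:
`s^λ_δ ∘ s^μ_δ = s^{λμ}_δ` (`h(δ,δ) = ε`, `ε² = 1`). [cite: CarlsonToledo1999, §7 Theorem udensitytheo] -/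
theorem complexReflection_comp (B : W →ₗ⋆[ℂ] W →ₗ[ℂ] ℂ) {ε : ℂ} (hε : ε * ε = 1) (l m : ℂ) {δ : W}
    (hδ : B δ δ = ε) :
    complexReflection B ε l δ ∘ₗ complexReflection B ε m δ = complexReflection B ε (l * m) δ := by
  ext x
  rw [LinearMap.comp_apply, complexReflection_apply B ε m δ x, complexReflection_apply B ε l δ,
    complexReflection_apply B ε (l * m) δ x, map_add, map_smul, hδ, smul_eq_mul, add_assoc, ← add_smul]
  congr 2
  linear_combination (ε * (l - 1) * (m - 1) * B δ x) * hε

/-- `s^λ_δ * s^μ_δ = s^{λμ}_δ` in `End(W)`. [cite: CarlsonToledo1999, §7 Theorem udensitytheo] -/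
theorem complexReflection_mul (B : W →ₗ⋆[ℂ] W →ₗ[ℂ] ℂ) {ε : ℂ} (hε : ε * ε = 1) (l m : ℂ) {δ : W}
    (hδ : B δ δ = ε) :
    complexReflection B ε l δ * complexReflection B ε m δ = complexReflection B ε (l * m) δ :=
  complexReflection_comp B hε l m hδ

/-- Powers: `(s^λ_δ)^k = s^{λ^k}_δ`. [cite: CarlsonToledo1999, §7 Theorem udensitytheo] -/
theorem complexReflection_pow (B : W →ₗ⋆[ℂ] W →ₗ[ℂ] ℂ) {ε : ℂ} (hε : ε * ε = 1) (l : ℂ) {δ : W}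
    (hδ : B δ δ = ε) (k : ℕ) :
    complexReflection B ε l δ ^ k = complexReflection B ε (l ^ k) δ := by
  induction k with
  | zero => rw [pow_zero, pow_zero, complexReflection_one]; rfl
  | succ k ih => rw [pow_succ, ih, complexReflection_mul B hε _ _ hδ, pow_succ]

/-- A reflection with eigenvalue a root of unity `λ`, `λ^N = 1`, has finite order dividing `N`
("transformation of order `k`", §6). [cite: CarlsonToledo1999, §6 and §7 Theorem udensitytheo] -/
theorem complexReflection_pow_eq_one (B : W →ₗ⋆[ℂ] W →ₗ[ℂ] ℂ) {ε : ℂ} (hε : ε * ε = 1) {l : ℂ}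
    {N : ℕ} (hl : l ^ N = 1) {δ : W} (hδ : B δ δ = ε) : complexReflection B ε l δ ^ N = 1 := by
  rw [complexReflection_pow B hε l hδ, hl, complexReflection_one]; rfl

/-- The complex reflection as an AUTOMORPHISM of `W` (`λ ≠ 0`, `h(δ,δ) = ε`, `ε² = 1`), with inverse
`s^{λ⁻¹}_δ`; so the source's "subgroup of `U(p,q)` generated by the `s_δ`" is a subgroup of `GL(W)`.
[cite: CarlsonToledo1999, §7 Theorem udensitytheo] -/
def complexReflectionEquiv (B : W →ₗ⋆[ℂ] W →ₗ[ℂ] ℂ) {ε : ℂ} (hε : ε * ε = 1) {l : ℂ} (hl : l ≠ 0)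
    {δ : W} (hδ : B δ δ = ε) : W ≃ₗ[ℂ] W :=
  LinearEquiv.ofLinear (complexReflection B ε l δ) (complexReflection B ε l⁻¹ δ)
    (by rw [complexReflection_comp B hε _ _ hδ, mul_inv_cancel₀ hl, complexReflection_one])
    (by rw [complexReflection_comp B hε _ _ hδ, inv_mul_cancel₀ hl, complexReflection_one])

/-- [cite: CarlsonToledo1999, §7 Theorem udensitytheo] -/
@[simp] theorem complexReflectionEquiv_apply (B : W →ₗ⋆[ℂ] W →ₗ[ℂ] ℂ) {ε : ℂ} (hε : ε * ε = 1)
    {l : ℂ} (hl : l ≠ 0) {δ : W} (hδ : B δ δ = ε) (x : W) :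
    complexReflectionEquiv B hε hl hδ x = complexReflection B ε l δ x := rfl

/-- [cite: CarlsonToledo1999, §7 Theorem udensitytheo] -/
theorem coe_complexReflectionEquiv (B : W →ₗ⋆[ℂ] W →ₗ[ℂ] ℂ) {ε : ℂ} (hε : ε * ε = 1)
    {l : ℂ} (hl : l ≠ 0) {δ : W} (hδ : B δ δ = ε) :
    (complexReflectionEquiv B hε hl hδ : W →ₗ[ℂ] W) = complexReflection B ε l δ := rfl

/-- For a root of unity (indeed any `λ` with `λ^N = 1`, `N > 0`): `conj λ · λ = 1`. [cite: CarlsonToledo1999, §7 Theorem udensitytheo] -/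
theorem conj_mul_self_eq_one_of_pow_eq_one {l : ℂ} {N : ℕ} (hN : 0 < N) (hl : l ^ N = 1) :
    starRingEnd ℂ l * l = 1 := by
  have h1 : ‖l‖ = 1 := Complex.norm_eq_one_of_pow_eq_one hl hN.ne'
  rw [mul_comm, Complex.mul_conj, Complex.normSq_eq_norm_sq, h1]
  simp

/-- **A complex `λ`-reflection along a unit vector is unitary**: for `h` hermitian, `h(δ,δ) = ε`, `ε = ±1`
real, `|λ| = 1` (as `conj λ · λ = 1`), `h(s_δ x, s_δ y) = h(x, y)` — the source's "`Γ` […] subgroup of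
`U(p,q)` generated by the complex reflections". [cite: CarlsonToledo1999, §7 Theorem udensitytheo] -/
theorem complexReflection_isometry {B : W →ₗ⋆[ℂ] W →ₗ[ℂ] ℂ} (hB : B.IsSymm) {ε : ℂ}
    (hε : ε * ε = 1) (hεr : starRingEnd ℂ ε = ε) {l : ℂ} (hl : starRingEnd ℂ l * l = 1) {δ : W}
    (hδ : B δ δ = ε) (x y : W) :
    B (complexReflection B ε l δ x) (complexReflection B ε l δ y) = B x y := by
  have hxδ : B x δ = starRingEnd ℂ (B δ x) := (hB.eq δ x).symm
  simp only [complexReflection_apply, map_add, map_smul, LinearMap.add_apply, LinearMap.smul_apply,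
    LinearMap.map_smulₛₗ, smul_eq_mul, hδ, hxδ, map_mul, map_sub, map_one, hεr]
  linear_combination (ε * starRingEnd ℂ (B δ x) * B δ y) * hl
    + (ε * starRingEnd ℂ (B δ x) * B δ y * (starRingEnd ℂ l - 1) * (l - 1)) * hε

/-- **(reflectionconjugacy)** `u⁻¹ s_δ u = s_{u⁻¹(δ)}` for an `h`-unitary `u`. [cite: CarlsonToledo1999, §7 (reflectionconjugacy), p. 15] -/
theorem complexReflection_conj (B : W →ₗ⋆[ℂ] W →ₗ[ℂ] ℂ) (u : W ≃ₗ[ℂ] W)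
    (hu : ∀ x y, B (u x) (u y) = B x y) (ε l : ℂ) (δ x : W) :
    u.symm (complexReflection B ε l δ (u x)) = complexReflection B ε l (u.symm δ) x := by
  simp only [complexReflection_apply, map_add, map_smul, LinearEquiv.symm_apply_apply]
  rw [← hu (u.symm δ) x, LinearEquiv.apply_symm_apply]

/-- The group generated by `λ`-reflections along unit vectors `δ ∈ Δ` (`h(δ,δ) = ε = ±1`, `|λ| = 1`), as
a subgroup of `GL(W)`, consists of `h`-unitary transformations: "`Γ` [is a] subgroup of `U(p,q)`".
[cite: CarlsonToledo1999, §7 Theorem udensitytheo] -/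
theorem isometry_of_mem_closure_setOf_coe_eq_complexReflection {B : W →ₗ⋆[ℂ] W →ₗ[ℂ] ℂ} (hB : B.IsSymm)
    {ε : ℂ} (hε : ε * ε = 1) (hεr : starRingEnd ℂ ε = ε) {l : ℂ} (hl : starRingEnd ℂ l * l = 1)
    {Δ : Set W} (hΔ : ∀ δ ∈ Δ, B δ δ = ε) {g : W ≃ₗ[ℂ] W}
    (hg : g ∈ Subgroup.closure {g : W ≃ₗ[ℂ] W | ∃ δ ∈ Δ, (g : W →ₗ[ℂ] W) = complexReflection B ε l δ}) :
    ∀ x y, B (g x) (g y) = B x y := by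
  refine Subgroup.closure_induction (fun g hg => ?_) (fun x y => rfl) (fun g g' _ _ hg hg' x y => ?_)
    (fun g _ hg x y => ?_) hg
  · obtain ⟨δ, hδΔ, hgδ⟩ := hg
    intro x y
    have hx : g x = complexReflection B ε l δ x := by rw [← hgδ]; rfl
    have hy : g y = complexReflection B ε l δ y := by rw [← hgδ]; rfl
    rw [hx, hy, complexReflection_isometry hB hε hεr hl (hΔ δ hδΔ)]
  · rw [LinearEquiv.mul_apply, LinearEquiv.mul_apply, hg, hg']
  · have h := hg (g.symm x) (g.symm y)
    rw [LinearEquiv.apply_symm_apply, LinearEquiv.apply_symm_apply] at h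
    exact h.symm

end Reflection

/-! ### §2 Real points: `GL_ℂ(W) → GL_ℝ(W)`, the unit scalars `U(1)`, and `Γ·U(1)` -/

section RealPoints

variable (W : Type*) [AddCommGroup W] [Module ℂ W]

/-- Restriction of scalars `GL_ℂ(W) →* GL_ℝ(W)` to the real vector space underlying `W`
(`Module.complexToReal`): the real points in which "Zariski-dense in `PU(p,q)`" (a REAL algebraic
group) is read. [cite: CarlsonToledo1999, §7 Theorem udensitytheo] -/
def restrictScalarsRealHom : (W ≃ₗ[ℂ] W) →* (W ≃ₗ[ℝ] W) where
  toFun g := g.restrictScalars ℝ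
  map_one' := by ext; rfl
  map_mul' _ _ := by ext; rfl

/-- [cite: CarlsonToledo1999, §7 Theorem udensitytheo] -/
@[simp] theorem restrictScalarsRealHom_apply (g : W ≃ₗ[ℂ] W) (x : W) :
    restrictScalarsRealHom W g x = g x := rfl

/-- [cite: CarlsonToledo1999, §7 Theorem udensitytheo] -/
theorem restrictScalarsRealHom_injective : Function.Injective (restrictScalarsRealHom W) :=
  fun g g' h => LinearEquiv.ext fun x => by
    simpa using congrArg (fun e : W ≃ₗ[ℝ] W => e x) h

/-- The **unit scalars** `U(1) = {z·1 : |z| = 1} ≤ GL_ℝ(W)` — the centre of `U(p,q)`, the kernel of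
`U(p,q) → PU(p,q)` ("we use `PA` to denote its projection in […] `PU(p,q)`"). [cite: CarlsonToledo1999, §7 p. 15 L9–10] -/
def unitScalarSubgroup : Subgroup (W ≃ₗ[ℝ] W) where
  carrier := {g | ∃ z : ℂ, ‖z‖ = 1 ∧ ∀ x, g x = z • x}
  one_mem' := ⟨1, by simp, fun x => by simp⟩
  mul_mem' := by
    rintro g g' ⟨z, hz, hg⟩ ⟨z', hz', hg'⟩
    exact ⟨z * z', by simp [hz, hz'], fun x => by simp [hg, hg', mul_smul]⟩
  inv_mem' := by
    rintro g ⟨z, hz, hg⟩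
    have hz0 : z ≠ 0 := fun h => by simp [h] at hz
    refine ⟨z⁻¹, by simp [hz], fun x => g.injective ?_⟩
    change g (g.symm x) = g (z⁻¹ • x)
    rw [LinearEquiv.apply_symm_apply, hg, smul_smul, mul_inv_cancel₀ hz0, one_smul]

/-- [cite: CarlsonToledo1999, §7 p. 15 L9–10] -/
theorem mem_unitScalarSubgroup_iff (g : W ≃ₗ[ℝ] W) :
    g ∈ unitScalarSubgroup W ↔ ∃ z : ℂ, ‖z‖ = 1 ∧ ∀ x, g x = z • x := Iff.rfl

/-- `Γ·U(1) ≤ GL_ℝ(W)`: the subgroup generated by (the real points of) `Γ ≤ GL_ℂ(W)` and the unit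
scalars — the preimage of `PΓ` under `U(p,q) → PU(p,q)` when `Γ ≤ U(p,q)`. Its real Zariski closure
`glZariskiClosure (realPointsWithUnitScalars W Γ)` is the carrier of "the Zariski closure of `PΓ` in
`PU(p,q)`". [cite: CarlsonToledo1999, §7 Theorem udensitytheo] -/
def realPointsWithUnitScalars (Γ : Subgroup (W ≃ₗ[ℂ] W)) : Subgroup (W ≃ₗ[ℝ] W) :=
  Γ.map (restrictScalarsRealHom W) ⊔ unitScalarSubgroup W

/-- [cite: CarlsonToledo1999, §7 Theorem udensitytheo] -/
theorem restrictScalarsRealHom_mem_realPointsWithUnitScalars {Γ : Subgroup (W ≃ₗ[ℂ] W)}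
    {g : W ≃ₗ[ℂ] W} (hg : g ∈ Γ) : restrictScalarsRealHom W g ∈ realPointsWithUnitScalars W Γ :=
  Subgroup.mem_sup_left (Subgroup.mem_map_of_mem _ hg)

/-- [cite: CarlsonToledo1999, §7 Theorem udensitytheo] -/
theorem unitScalarSubgroup_le_realPointsWithUnitScalars (Γ : Subgroup (W ≃ₗ[ℂ] W)) :
    unitScalarSubgroup W ≤ realPointsWithUnitScalars W Γ :=
  le_sup_right

end RealPoints

/-! ### §3 The density theorem (named fact) -/

/-- **Carlson–Toledo 1999, §7, Theorem `udensitytheo` — density of unitary reflection groups** (NAMED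
FACT; cited, not proved here). Verbatim: "Let `ε = ±1` be fixed, and let `Δ` be a set of vectors in a
hermitian space `ℂ(p,q)` which lie in the unit quadric `h(δ,δ) = ε`. Fix a root of unity `λ ≠ ±1` and let
`Γ` be the subgroup of `U(p,q)` generated by the complex reflections `s_δ(x) = x + ε(λ − 1)h(x,δ)δ` for
all `δ` in `Δ`. Suppose that `p + q > 1`, that `Δ` consists of a single `Γ`-orbit, and that `Δ` spans
`ℂ(p,q)`. Then either `Γ` is finite or `PΓ` Zariski-dense in `PU(p,q)`." (`PA` = "its projection in
[…] `PU(p,q)`"; proof pp. 15–16, adapting Deligne, Weil II §4.4.)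

Rendering. `ℂ(p,q)` = any finite-dimensional complex `W` with a non-degenerate hermitian form `B`
(Mathlib sesquilinear, conjugate-linear in the first slot; `h(x,δ) = B δ x`; `(p,q)` = its signature, so
"`p + q > 1`" is `2 ≤ finrank ℂ W`); `s_δ = complexReflection B ε λ δ`; `Γ ≤ GL(W)` is generated by the
automorphisms with underlying map some `s_δ`, `δ ∈ Δ` (these exist: `complexReflectionEquiv`; and
`Γ ≤ U(W,h)`: `isometry_of_mem_closure_setOf_coe_eq_complexReflection`); "single `Γ`-orbit" = `Γ`-stable
and `Γ`-transitive (`Δ ≠ ∅` being forced by the spanning clause). CONCLUSION on real points, in the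
vocabulary of `glZariskiClosure` (`K = ℝ`, the real vector space underlying `W`): `Γ` is finite, OR every
`h`-unitary automorphism of `W` lies in the real Zariski closure of `Γ·U(1)`
(`realPointsWithUnitScalars W Γ`), i.e. every real polynomial in the real matrix entries vanishing on
`Γ·U(1)` vanishes on `U(W,h)`. (This IS "`PΓ` Zariski-dense in `PU(p,q)`": `U(1)(ℝ) = S¹` and
`U(p,q)(ℝ) = U(W,h)` are Zariski dense in the connected real algebraic groups `U(1)`, `U(p,q)`; the
Zariski closure `G` of `Γ·S¹` is an algebraic subgroup of `U(p,q)` containing the central `U(1)`, the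
kernel of `U(p,q) → PU(p,q)`, and `G = U(p,q)` iff `G/U(1)` = the closure of `PΓ` equals `PU(p,q)`.)
`-- TODO(general form): Theorem udensityprop (M the smallest algebraic subgroup containing the s_δ, R a
single M-orbit ⇒ M finite or PM = PU(p,q)) and Lemma Ulemma are not vendored; nor the algebraic-group
consequence SU(W,h) ⊆ (closure of Γ)(ℝ).`
[cite: CarlsonToledo1999, §7 Theorem udensitytheo] -/
def carlsonToledo1999_unitaryReflection_zariskiDense : Prop :=
  ∀ (W : Type) [AddCommGroup W] [Module ℂ W] [FiniteDimensional ℂ W] (B : W →ₗ⋆[ℂ] W →ₗ[ℂ] ℂ),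
    B.IsSymm → B.Nondegenerate → 2 ≤ finrank ℂ W →
  ∀ (ε : ℂ), (ε = 1 ∨ ε = -1) →
  ∀ (l : ℂ), (∃ N : ℕ, 0 < N ∧ l ^ N = 1) → l ≠ 1 → l ≠ -1 →
  ∀ (Δ : Set W), (∀ δ ∈ Δ, B δ δ = ε) → Submodule.span ℂ Δ = ⊤ →
  ∀ (Γ : Subgroup (W ≃ₗ[ℂ] W)),
    Γ = Subgroup.closure {g : W ≃ₗ[ℂ] W | ∃ δ ∈ Δ, (g : W →ₗ[ℂ] W) = complexReflection B ε l δ} →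
    (∀ g ∈ Γ, ∀ δ ∈ Δ, g δ ∈ Δ) → (∀ δ ∈ Δ, ∀ δ' ∈ Δ, ∃ g ∈ Γ, g δ = δ') →
    (Γ : Set (W ≃ₗ[ℂ] W)).Finite ∨
      ∀ u : W ≃ₗ[ℂ] W, (∀ x y, B (u x) (u y) = B x y) →
        restrictScalarsRealHom W u ∈ glZariskiClosure (realPointsWithUnitScalars W Γ)

/-! ### §4 Proved consequences in the consumer's shape -/

section Consequences

variable {W : Type} [AddCommGroup W] [Module ℂ W]

/-- The hypotheses `ε = ±1` of the theorem in the form the reflection calculus uses: `ε² = 1` and `ε`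
real. [cite: CarlsonToledo1999, §7 Theorem udensitytheo] -/
theorem sign_mul_self_and_conj {ε : ℂ} (hε : ε = 1 ∨ ε = -1) : ε * ε = 1 ∧ starRingEnd ℂ ε = ε := by
  rcases hε with rfl | rfl <;> simp

/-- The generators are genuine elements of `Γ`: for `δ ∈ Δ` the automorphism `complexReflectionEquiv`
(underlying map `s_δ`) lies in `Γ`. [cite: CarlsonToledo1999, §7 Theorem udensitytheo] -/
theorem complexReflectionEquiv_mem_closure (B : W →ₗ⋆[ℂ] W →ₗ[ℂ] ℂ) {ε : ℂ} (hε : ε * ε = 1) {l : ℂ}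
    (hl : l ≠ 0) {Δ : Set W} (hΔ : ∀ δ ∈ Δ, B δ δ = ε) {δ : W} (hδ : δ ∈ Δ) :
    complexReflectionEquiv B hε hl (hΔ δ hδ) ∈
      Subgroup.closure {g : W ≃ₗ[ℂ] W | ∃ δ ∈ Δ, (g : W →ₗ[ℂ] W) = complexReflection B ε l δ} :=
  Subgroup.subset_closure ⟨δ, hδ, rfl⟩

variable [FiniteDimensional ℂ W]

/-- **The density theorem for an INFINITE reflection group** (the form Line R of the consumer uses, the
finite case being excluded separately): under the hypotheses of Theorem `udensitytheo`, if `Γ` is infinite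
then every `h`-unitary automorphism lies in the real Zariski closure of `Γ·U(1)`.
[cite: CarlsonToledo1999, §7 Theorem udensitytheo] -/
theorem carlsonToledo1999_unitaryReflection_zariskiDense.mem_glZariskiClosure_of_infinite
    (hCT : carlsonToledo1999_unitaryReflection_zariskiDense) {B : W →ₗ⋆[ℂ] W →ₗ[ℂ] ℂ} (hB : B.IsSymm)
    (hBn : B.Nondegenerate) (hW : 2 ≤ finrank ℂ W) {ε : ℂ} (hε : ε = 1 ∨ ε = -1) {l : ℂ}
    (hlN : ∃ N : ℕ, 0 < N ∧ l ^ N = 1) (hl1 : l ≠ 1) (hl2 : l ≠ -1) {Δ : Set W}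
    (hΔ : ∀ δ ∈ Δ, B δ δ = ε) (hspan : Submodule.span ℂ Δ = ⊤) {Γ : Subgroup (W ≃ₗ[ℂ] W)}
    (hΓ : Γ = Subgroup.closure {g : W ≃ₗ[ℂ] W | ∃ δ ∈ Δ, (g : W →ₗ[ℂ] W) = complexReflection B ε l δ})
    (hstab : ∀ g ∈ Γ, ∀ δ ∈ Δ, g δ ∈ Δ) (htrans : ∀ δ ∈ Δ, ∀ δ' ∈ Δ, ∃ g ∈ Γ, g δ = δ')
    (hinf : (Γ : Set (W ≃ₗ[ℂ] W)).Infinite) {u : W ≃ₗ[ℂ] W} (hu : ∀ x y, B (u x) (u y) = B x y) :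
    restrictScalarsRealHom W u ∈ glZariskiClosure (realPointsWithUnitScalars W Γ) :=
  ((hCT W B hB hBn hW ε hε l hlN hl1 hl2 Δ hΔ hspan Γ hΓ hstab htrans).resolve_left hinf) u hu

/-- Under the theorem's hypotheses `Γ ≤ U(W,h)`, so in the infinite case `Γ` itself (through its real
points) lies in the closure trivially and the content is the converse containment `U(W,h) ⊆ closure`; recorded
here: the real points of `Γ` lie in `glZariskiClosure (Γ·U(1))`. [cite: CarlsonMullerStachPeters2017, Lemma–Definition 15.3.7] -/
theorem restrictScalarsRealHom_mem_glZariskiClosure {Γ : Subgroup (W ≃ₗ[ℂ] W)} {g : W ≃ₗ[ℂ] W}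
    (hg : g ∈ Γ) : restrictScalarsRealHom W g ∈ glZariskiClosure (realPointsWithUnitScalars W Γ) :=
  subset_glZariskiClosure _ (restrictScalarsRealHom_mem_realPointsWithUnitScalars W hg)

end Consequences

end Literature.AlgebraicGeometry.HodgeTheory
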